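import Summits.QuantumAdvantage.AdviceFreeQNC0.BlockAdditivePairs
import Summits.QuantumAdvantage.AdviceFreeQNC0.BlockAdditiveCycle
import HarnessLib

/-!
# Cell qa-qnc0 (rung F-Q1, route RingFrame, crux α, line `product`): block-additive maps — the
# LANDING COUNT (qn-p1 TARGET §20.8, ask P6e; PROVER-MEMO-gen4 §2 step (3))

Fourth file of the prover's τ''-free proof of `Sketch8b.BlockAdditiveFSB`, PROVED: if every type-1
move outside an exceptional set `E` has increment of norm `< (c−1)θ·2^{L'}`, then the `cθ`-far rows
of class `r + 2` are controlled by the exceptional class-`r` set `B = FAR_θ ∩ cls r` and `#E`: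

  `#(FAR_{cθ} ∩ cls(r+2)) · k · 2^L ≤ 6·#E + 3·k·2^L·#B`        (`card_far_cls_succ_succ_le`).

Mechanism: every (far row `u`, block `i`, type-1 pattern `y`) — at least `k·2^L/6` of them per row —
either uses an exceptional move `(i, u, y) ∈ E` or lands, by `far_bmove_of_cnorm_lt`, in `B`; the
landing configurations are counted WITHOUT fibres through the involution
`(u, i, y) ↦ (u∘(i,y), i, y∘(i,u))` (`landInv`), under which they become (row of `B`, block, type-2
pattern) triples, at most `k·2^L/2` per row of `B`.  The exceptional triples are counted over ALL rows
(not only far ones), which is what makes the bound linear in `#B` and `#E` with no typicality input.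

What remains for `BlockAdditiveFSB` (next prover): Markov on `card_badPairs_le` to produce `E` with
`#E = O(k·2^L·#B)`, the common-partner and three-cycle existence (`k ≥ 21`), the symmetric class
`r + 1` (type-2 moves = reversed type-1 moves), and the assembly.  WHAT THIS IS NOT: nothing on
FSB/FW at general column degree, nothing on α; no separation claim.
-/

noncomputable section

namespace Summit.QuantumAdvantage.AdviceFreeQNC0

open Finset
open Literature.Computability.MetaComplexity Literature.Computability.MetaComplexity.Smolensky

namespace BlockAdditive

variable {L L' k : ℕ}

section Landing

open Classical

/-- The landing involution `(u, i, y) ↦ (u∘(i,y), i, y∘(i,u))`. -/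
def landInv (blk : Fin L → Fin k) :
    (Fin L → Bool) × Fin k × (Fin L → Bool) → (Fin L → Bool) × Fin k × (Fin L → Bool) :=
  fun q => (bmove blk q.1 q.2.1 q.2.2, q.2.1, bmove blk q.2.2 q.2.1 q.1)

/-- The landing map is an involution. -/
theorem landInv_involutive (blk : Fin L → Fin k) : Function.Involutive (landInv blk) := by
  intro q
  obtain ⟨u, i, y⟩ := q
  simp only [landInv, Prod.mk.injEq]
  refine ⟨?_, trivial, ?_⟩
  · funext l
    by_cases h : blk l = i
    · simp [bmove, h]
    · simp [bmove, h]
  · funext l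
    by_cases h : blk l = i
    · simp [bmove, h]
    · simp [bmove, h]

/-- Under the landing involution a (row, block, type-1 pattern) triple landing in `T` becomes a
(row of `T`, block, type-2 pattern) triple. -/
theorem landInv_mem (blk : Fin L → Fin k) (T : Finset (Fin L → Bool))
    {q : (Fin L → Bool) × Fin k × (Fin L → Bool)} (ht : typ blk (q.2.1, q.1, q.2.2) 1)
    (hl : bmove blk q.1 q.2.1 q.2.2 ∈ T) :
    (landInv blk q).1 ∈ T ∧ typ blk ((landInv blk q).2.1, (landInv blk q).1, (landInv blk q).2.2) 2 := by
  refine ⟨hl, ?_⟩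
  unfold typ at ht ⊢
  simp only [landInv] at ht ⊢
  rw [wtOn_on_bmove, wtOn_on_bmove]
  omega

/-- **The landing configurations are few**: `#{(u,i,y) : type-1, u∘(i,y) ∈ T} ≤ #T·k·2^L/2`. -/
theorem card_landing_le (blk : Fin L → Fin k)
    (hblk : ∀ i : Fin k, 2 ≤ (univ.filter fun j : Fin L => blk j = i).card)
    (T : Finset (Fin L → Bool)) :
    2 * ((univ.filter fun q : (Fin L → Bool) × Fin k × (Fin L → Bool) =>
        typ blk (q.2.1, q.1, q.2.2) 1 ∧ bmove blk q.1 q.2.1 q.2.2 ∈ T).card : ℝ) ≤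
      (T.card : ℝ) * k * (2 : ℝ) ^ L := by
  -- map into (row of T, block, type-2 pattern) triples by the involution
  have hinv := landInv_involutive blk
  let σ : Equiv.Perm ((Fin L → Bool) × Fin k × (Fin L → Bool)) := hinv.toPerm _
  have h1 : (univ.filter fun q : (Fin L → Bool) × Fin k × (Fin L → Bool) =>
        typ blk (q.2.1, q.1, q.2.2) 1 ∧ bmove blk q.1 q.2.1 q.2.2 ∈ T).card ≤
      (univ.filter fun q : (Fin L → Bool) × Fin k × (Fin L → Bool) =>
        q.1 ∈ T ∧ typ blk (q.2.1, q.1, q.2.2) 2).card := by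
    refine Finset.card_le_card_of_injOn (landInv blk) (fun q hq => ?_) fun q _ q' _ h => hinv.injective h
    rw [Finset.mem_coe, Finset.mem_filter] at hq
    rw [Finset.mem_coe, Finset.mem_filter]
    exact ⟨Finset.mem_univ _, landInv_mem blk T hq.2.1 hq.2.2⟩
  -- count the target triples: Σ_{w ∈ T} Σ_i #{y' : type 2} ≤ #T·k·2^L/2
  have h2 : 2 * ((univ.filter fun q : (Fin L → Bool) × Fin k × (Fin L → Bool) =>
        q.1 ∈ T ∧ typ blk (q.2.1, q.1, q.2.2) 2).card : ℝ) ≤ (T.card : ℝ) * k * (2 : ℝ) ^ L := by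
    rw [card_filter_prod_eq_sum (fun (w : Fin L → Bool) (iy : Fin k × (Fin L → Bool)) =>
      w ∈ T ∧ typ blk (iy.1, w, iy.2) 2)]
    push_cast
    rw [Finset.mul_sum]
    have hw : ∀ w : Fin L → Bool,
        2 * (((univ.filter fun iy : Fin k × (Fin L → Bool) => w ∈ T ∧ typ blk (iy.1, w, iy.2) 2).card
          : ℕ) : ℝ) ≤ (if w ∈ T then (1 : ℝ) else 0) * k * (2 : ℝ) ^ L := by
      intro w
      by_cases hT : w ∈ T
      · rw [if_pos hT, one_mul]
        rw [card_filter_prod_eq_sum (fun (i : Fin k) (y : Fin L → Bool) => w ∈ T ∧ typ blk (i, w, y) 2)]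
        push_cast
        rw [Finset.mul_sum]
        calc (∑ i : Fin k, 2 * (((univ.filter fun y : Fin L → Bool => w ∈ T ∧ typ blk (i, w, y) 2).card
              : ℕ) : ℝ))
            ≤ ∑ _i : Fin k, (2 : ℝ) ^ L := by
              refine Finset.sum_le_sum fun i _ => ?_
              have e : (univ.filter fun y : Fin L → Bool => w ∈ T ∧ typ blk (i, w, y) 2) =
                  univ.filter fun y : Fin L → Bool => typ blk (i, w, y) 2 :=
                Finset.filter_congr fun y _ => by simp [hT]
              rw [e]
              exact card_typ_le blk hblk i w 2
          _ = (k : ℝ) * (2 : ℝ) ^ L := by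
              rw [Finset.sum_const, Finset.card_univ, Fintype.card_fin, nsmul_eq_mul]
      · rw [if_neg hT]
        have e : (univ.filter fun iy : Fin k × (Fin L → Bool) => w ∈ T ∧ typ blk (iy.1, w, iy.2) 2) = ∅ :=
          Finset.filter_eq_empty_iff.2 fun iy _ h => hT h.1
        rw [e, Finset.card_empty]
        simp
    calc (∑ w : Fin L → Bool, 2 * (((univ.filter fun iy : Fin k × (Fin L → Bool) =>
          w ∈ T ∧ typ blk (iy.1, w, iy.2) 2).card : ℕ) : ℝ))
        ≤ ∑ w : Fin L → Bool, (if w ∈ T then (1 : ℝ) else 0) * k * (2 : ℝ) ^ L :=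
          Finset.sum_le_sum fun w _ => hw w
      _ = (T.card : ℝ) * k * (2 : ℝ) ^ L := by
          rw [← Finset.sum_mul, ← Finset.sum_mul, Finset.sum_boole, Finset.filter_univ_mem]
  have h1' : ((univ.filter fun q : (Fin L → Bool) × Fin k × (Fin L → Bool) =>
        typ blk (q.2.1, q.1, q.2.2) 1 ∧ bmove blk q.1 q.2.1 q.2.2 ∈ T).card : ℝ) ≤
      ((univ.filter fun q : (Fin L → Bool) × Fin k × (Fin L → Bool) =>
        q.1 ∈ T ∧ typ blk (q.2.1, q.1, q.2.2) 2).card : ℝ) := by exact_mod_cast h1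
  linarith

/-- **Every far row has many type-1 moves**: `#{(u,i,y) : u ∈ F, type 1} · 6 ≥ #F·k·2^L`. -/
theorem card_moves_from_ge (blk : Fin L → Fin k)
    (hblk : ∀ i : Fin k, 2 ≤ (univ.filter fun j : Fin L => blk j = i).card)
    (F : Finset (Fin L → Bool)) :
    (F.card : ℝ) * k * (2 : ℝ) ^ L ≤
      6 * ((univ.filter fun q : (Fin L → Bool) × Fin k × (Fin L → Bool) =>
        q.1 ∈ F ∧ typ blk (q.2.1, q.1, q.2.2) 1).card : ℝ) := by
  rw [card_filter_prod_eq_sum (fun (u : Fin L → Bool) (iy : Fin k × (Fin L → Bool)) =>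
    u ∈ F ∧ typ blk (iy.1, u, iy.2) 1)]
  push_cast
  rw [Finset.mul_sum]
  have hu : ∀ u : Fin L → Bool, (if u ∈ F then (1 : ℝ) else 0) * k * (2 : ℝ) ^ L ≤
      6 * (((univ.filter fun iy : Fin k × (Fin L → Bool) => u ∈ F ∧ typ blk (iy.1, u, iy.2) 1).card
        : ℕ) : ℝ) := by
    intro u
    by_cases hF : u ∈ F
    · rw [if_pos hF, one_mul]
      rw [card_filter_prod_eq_sum (fun (i : Fin k) (y : Fin L → Bool) => u ∈ F ∧ typ blk (i, u, y) 1)]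
      push_cast
      rw [Finset.mul_sum]
      calc (k : ℝ) * (2 : ℝ) ^ L = ∑ _i : Fin k, (2 : ℝ) ^ L := by
            rw [Finset.sum_const, Finset.card_univ, Fintype.card_fin, nsmul_eq_mul]
        _ ≤ ∑ i : Fin k, 6 * (((univ.filter fun y : Fin L → Bool => u ∈ F ∧ typ blk (i, u, y) 1).card
              : ℕ) : ℝ) := by
            refine Finset.sum_le_sum fun i _ => ?_
            have e : (univ.filter fun y : Fin L → Bool => u ∈ F ∧ typ blk (i, u, y) 1) =
                univ.filter fun y : Fin L → Bool => typ blk (i, u, y) 1 :=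
              Finset.filter_congr fun y _ => by simp [hF]
            rw [e]
            exact card_typ_ge blk hblk i u 1
    · rw [if_neg hF]
      simp only [zero_mul]
      positivity
  calc (F.card : ℝ) * k * (2 : ℝ) ^ L
      = ∑ u : Fin L → Bool, (if u ∈ F then (1 : ℝ) else 0) * k * (2 : ℝ) ^ L := by
        rw [← Finset.sum_mul, ← Finset.sum_mul, Finset.sum_boole, Finset.filter_univ_mem]
    _ ≤ ∑ u : Fin L → Bool, 6 * (((univ.filter fun iy : Fin k × (Fin L → Bool) =>
          u ∈ F ∧ typ blk (iy.1, u, iy.2) 1).card : ℕ) : ℝ) := Finset.sum_le_sum fun u _ => hu u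

/-- **THE LANDING COUNT** (PROVER-MEMO-gen4 §2 step (3)): if every type-1 move outside `E` has
increment of norm `< (c−1)θ·2^{L'}`, then
`#(FAR_{cθ} ∩ cls(r+2)) · k · 2^L ≤ 6·#E + 3·k·2^L·#(FAR_θ ∩ cls r)`. -/
theorem card_far_cls_succ_succ_le (blk : Fin L → Fin k)
    (G : Fin k → (Fin L → Bool) → (Fin L' → Bool) → Bool) (hG : BlockLocal blk G)
    (hblk : ∀ i : Fin k, 2 ≤ (univ.filter fun j : Fin L => blk j = i).card)
    (D : ℕ) (θ c : ℝ) (r : ℕ) (E : Finset (Mv L k))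
    (hE : ∀ m : Mv L k, typ blk m 1 → m ∉ E → (cnorm D (incrM G m) : ℝ) < (c - 1) * θ * (2 : ℝ) ^ L') :
    ((far D (gammaBA G) (c * θ) ∩ cls L (r + 2)).card : ℝ) * k * (2 : ℝ) ^ L ≤
      6 * (E.card : ℝ) + 3 * k * (2 : ℝ) ^ L * ((far D (gammaBA G) θ ∩ cls L r).card : ℝ) := by
  set F := far D (gammaBA G) (c * θ) ∩ cls L (r + 2) with hF
  set B := far D (gammaBA G) θ ∩ cls L r with hB
  set SF := univ.filter fun q : (Fin L → Bool) × Fin k × (Fin L → Bool) =>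
      q.1 ∈ F ∧ typ blk (q.2.1, q.1, q.2.2) 1 with hSF
  set SE := univ.filter fun q : (Fin L → Bool) × Fin k × (Fin L → Bool) =>
      (q.2.1, q.1, q.2.2) ∈ E with hSE
  set SB := univ.filter fun q : (Fin L → Bool) × Fin k × (Fin L → Bool) =>
      typ blk (q.2.1, q.1, q.2.2) 1 ∧ bmove blk q.1 q.2.1 q.2.2 ∈ B with hSB
  -- every move from F is exceptional or lands in B
  have hsub : SF ⊆ SE ∪ SB := by
    intro q hq
    rw [hSF, Finset.mem_filter] at hq
    rw [Finset.mem_union, hSE, hSB, Finset.mem_filter, Finset.mem_filter]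
    by_cases he : (q.2.1, q.1, q.2.2) ∈ E
    · exact Or.inl ⟨Finset.mem_univ _, he⟩
    · refine Or.inr ⟨Finset.mem_univ _, hq.2.2, ?_⟩
      have hu := hq.2.1
      rw [hF, Finset.mem_inter] at hu
      rw [hB, Finset.mem_inter]
      refine ⟨far_bmove_of_cnorm_lt hG hu.1 q.2.1 q.2.2 (hE (q.2.1, q.1, q.2.2) hq.2.2 he), ?_⟩
      -- class: r + 2 + 1 ≡ r
      have hcls := hu.2
      unfold cls at hcls ⊢
      rw [Finset.mem_filter] at hcls ⊢
      refine ⟨Finset.mem_univ _, ?_⟩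
      have hw := wt_bmove blk q.1 q.2.1 q.2.2
      have ht := hq.2.2
      unfold typ at ht
      simp only at ht
      omega
  -- count the exceptional triples by #E
  have hSE_card : SE.card ≤ E.card := by
    refine Finset.card_le_card_of_injOn (fun q => (q.2.1, q.1, q.2.2)) (fun q hq => ?_) ?_
    · rw [Finset.mem_coe, hSE, Finset.mem_filter] at hq
      exact hq.2
    · intro q _ q' _ h
      simp only [Prod.mk.injEq] at h
      obtain ⟨h1, h2, h3⟩ := h
      exact Prod.ext h2 (Prod.ext h1 h3)
  have h1 := card_moves_from_ge blk hblk F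
  have h2 := card_landing_le blk hblk B
  have h3 : (SF.card : ℝ) ≤ (SE.card : ℝ) + (SB.card : ℝ) := by
    exact_mod_cast (Finset.card_le_card hsub).trans (Finset.card_union_le _ _)
  have h4 : (SE.card : ℝ) ≤ (E.card : ℝ) := by exact_mod_cast hSE_card
  rw [← hSF] at h1
  rw [← hSB] at h2
  nlinarith [h1, h2, h3, h4]

end Landing

end BlockAdditive

end Summit.QuantumAdvantage.AdviceFreeQNC0

end
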